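import Literature.AlgebraicGeometry.AbelianSchemes.AbelianSchemeConstSubgroupQuotient
import Literature.AlgebraicGeometry.RelativeSpec.ActionOverPullback
import Literature.AlgebraicGeometry.RelativeSpec.GeometricQuotientGroupLaw
import Literature.AlgebraicGeometry.RelativeSpec.GeometricQuotientFreeEquivariantDescent
import HarnessLib

/-!
# The translation action on `B ×_S Â` through the second factor, over `1 × ψ̂ : B ×_S Â → B ×_S (Â/K′)`
# (HECKE-LINK file (ii), brick D3a; Mumford, *Abelian Varieties* §7 Thm. 4, §15 Thm. 1)

Let `B`, `Â` be abelian schemes over `S → Y` (`Y` affine for the quotient theorems), `K′ ⊆ Â(S)` a finite group of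
sections acting by translations (★ `AbelianSchemeConstSubgroupQuotient`: `translation`, `translationActionOver`,
`quotientMk =: ψ̂ : Â → Â/K′`, `quotientActionOver`). On the fibre product `B ×_S Â` (the scheme
`(B.X ⊗ Â.X).left = pullback B.X.hom Â.X.hom` of the cartesian-monoidal `Over S`) the group `K′` acts by
`1 × t_k`, and the map along which the Poincaré-type sheaves of the two-step descent are pushed is
`1 × ψ̂ = (B.X ◁ ψ̂).left : B ×_S Â → B ×_S (Â/K′)`. This file supplies the three inputs
`(hq) [IsAffineHom] (hfree)` of the tree's equivariant-descent theorems (★ `ActionOver.exists_descent_of_free`,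
`moduleInvariants`, ★ `isPullback_of_equivariant_of_free`) for that map:

* `prodTranslationActionOver B Â u K′ hcov′ : ActionOver (B.X ◁ ψ̂).left K′` — THE ONE CONSTRUCTION: ★
  `ActionOver.onPullback` with the trivial actions on `B` and `S` and the translation action on `Â`;
  `prodTranslationActionOver_aut_hom` (`= pullback.map _ _ _ _ (𝟙 _) (t_k).left (𝟙 S) _ _`, i.e. `1 × t_k`),
  `…_aut_hom_fst` (`≫ pr_B = pr_B`), `…_aut_hom_snd` (`≫ pr_Â = pr_Â ≫ t_k`);
* `isAffineHom_whiskerLeft_quotientMk_left`, `isFinite_…`, `flat_…`, `surjective_…` — `1 × ψ̂` is a base change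
  of `ψ̂` (★ `IsGeometricQuotient.isPullback_whiskerLeft_left`);
* **`isGeometricQuotient_prodTranslationActionOver`** — `1 × ψ̂` is a geometric quotient for `1 × t_•` (★
  `isGeometricQuotient_baseChange_of_free` on the free quotient `ψ̂`, ★ `isGeometricQuotient_quotientActionOver`);
* **`prodTranslationActionOver_free`** — the action `1 × t_•` is free in the ring form on the affine charts of
  `B ×_S (Â/K′)` (★ `IsGeometricQuotient.free_of_equivariant` along the equivariant `pr_Â`).

Bridging to file (ii)'s binders: `(B.X ◁ ψ̂).left` and `pullback.map _ _ _ _ (𝟙 _) ψ̂.left (𝟙 S) _ _` agree by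
`rfl` (Mathlib `Over.whiskerLeft_left`), likewise `1 × t_k`. All `def`s are constructions with bodies; no named facts.

## References

* D. Mumford, *Abelian Varieties* (1970), §7 Thm. 4 (p. 72), §15 Thm. 1 (p. 143). [MumfordAV1970]
* A. Grothendieck, *SGA 1*, Exp. V §1, Prop. 2.6, Déf. 2.7. [SGA1]
-/

noncomputable section

universe u

open CategoryTheory CategoryTheory.Limits AlgebraicGeometry MonoidalCategory CartesianMonoidalCategory
open scoped MonObj

namespace Literature.AlgebraicGeometry.AbelianSchemes.AbelianSchemeOver

open Literature.AlgebraicGeometry.RelativeSpec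

variable {S : Scheme.{u}} (B Ah : AbelianSchemeOver S) {Y : Scheme.{u}} (u : S ⟶ Y) (K' : Subgroup Ah.Sections)

/-- The trivial action on `B` and the trivial action on `S` are compatible with `B → S`. [folklore] -/
private theorem compat_fst (k : K') :
    ((1 : K' →* Aut B.left) k).hom ≫ B.X.hom = B.X.hom ≫ ((1 : K' →* Aut S) k).hom :=
  (Category.id_comp _).trans (Category.comp_id _).symm

/-- `t_k.left ≫ (Â → S) = (Â → S)` against the trivial action on `S`. [folklore] -/
private theorem compat_snd (k : K') :
    ((Ah.translationActionOver u K').aut k).hom ≫ Ah.X.hom = Ah.X.hom ≫ ((1 : K' →* Aut S) k).hom :=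
  (Ah.aut_hom_comp_hom u K' k).trans (Category.comp_id _).symm

variable [Finite K'] [Y.IsSeparated] [IsSeparated (Ah.X.hom ≫ u)] [S.IsSeparated]
  (hcov' : ∀ x : Ah.left, ∃ O : (Ah.translationActionOver u K').StableAffineOpens, x ∈ O.1)

/-- **The `K′`-action `1 × t_•` on `B ×_S Â`, over `1 × ψ̂ : B ×_S Â → B ×_S (Â/K′)`** (★ `ActionOver.onPullback`
with the trivial action on `B`, the translation action on `Â`, the trivial action on `S`; `1 × t_k` commutes with
`1 × ψ̂` because `t_k ≫ ψ̂ = ψ̂`). [cite: MumfordAV1970, §7 Thm. 4 (p. 72)] -/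
def prodTranslationActionOver : ActionOver (B.X ◁ Ah.quotientMk u K' hcov').left K' :=
  ActionOver.onPullback B.X.hom Ah.X.hom (1 : K' →* Aut B.left) (Ah.translationActionOver u K').aut
    (1 : K' →* Aut S) (compat_fst B Ah K') (compat_snd Ah u K') (B.X ◁ Ah.quotientMk u K' hcov').left fun k => by
      change (B.X ◁ Ah.translation (k : Ah.Sections)).left ≫ _ = _
      rw [← Over.comp_left, ← MonoidalCategory.whiskerLeft_comp, Ah.translation_comp_quotientMk]

/-- **`1 × t_k` is the whiskering `B ◁ t_k`** (definitionally): the bridge to file (ii)'s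
`translateProd k = pullback.map _ _ _ _ (𝟙 _) (t_k).left (𝟙 S) _ _` (Mathlib `Over.whiskerLeft_left`, also `rfl`).
[cite: MumfordAV1970, §7 Thm. 4 (p. 72)] -/
theorem prodTranslationActionOver_aut_hom (k : K') :
    ((prodTranslationActionOver B Ah u K' hcov').aut k).hom = (B.X ◁ Ah.translation (k : Ah.Sections)).left := rfl

/-- `(1 × t_k) ≫ pr_B = pr_B`. [cite: MumfordAV1970, §7 Thm. 4 (p. 72)] -/
theorem prodTranslationActionOver_aut_hom_fst (k : K') :
    ((prodTranslationActionOver B Ah u K' hcov').aut k).hom ≫ pullback.fst B.X.hom Ah.X.hom =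
      pullback.fst B.X.hom Ah.X.hom := by
  rw [prodTranslationActionOver_aut_hom]; exact Over.whiskerLeft_left_fst _

/-- `(1 × t_k) ≫ pr_Â = pr_Â ≫ t_k`. [cite: MumfordAV1970, §7 Thm. 4 (p. 72)] -/
theorem prodTranslationActionOver_aut_hom_snd (k : K') :
    ((prodTranslationActionOver B Ah u K' hcov').aut k).hom ≫ pullback.snd B.X.hom Ah.X.hom =
      pullback.snd B.X.hom Ah.X.hom ≫ (Ah.translation (k : Ah.Sections)).left := by
  rw [prodTranslationActionOver_aut_hom]; exact Over.whiskerLeft_left_snd _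

/-- `1 × ψ̂` is affine (a base change of the affine `ψ̂`, ★ `isPullback_whiskerLeft_left`).
[cite: MumfordAV1970, §7 Thm. 4 (p. 72)] -/
theorem isAffineHom_whiskerLeft_quotientMk_left : IsAffineHom (B.X ◁ Ah.quotientMk u K' hcov').left :=
  haveI := Ah.isAffineHom_quotientMk_left u K' hcov'
  MorphismProperty.of_isPullback
    (ActionOver.IsGeometricQuotient.isPullback_whiskerLeft_left (Ah.quotientMk u K' hcov') B.X) ‹_›

/-- `1 × ψ̂` is finite (base change of the finite `ψ̂`). [cite: MumfordAV1970, §7 Thm. 4 (p. 72)] -/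
theorem isFinite_whiskerLeft_quotientMk_left [LocallyOfFiniteType (Ah.X.hom ≫ u)] :
    IsFinite (B.X ◁ Ah.quotientMk u K' hcov').left :=
  haveI := Ah.isFinite_quotientMk_left u K' hcov'
  MorphismProperty.of_isPullback
    (ActionOver.IsGeometricQuotient.isPullback_whiskerLeft_left (Ah.quotientMk u K' hcov') B.X) ‹_›

/-- `1 × ψ̂` is surjective (base change of the surjective `ψ̂`). [cite: MumfordAV1970, §7 Thm. 4 (p. 72)] -/
theorem surjective_whiskerLeft_quotientMk_left : Surjective (B.X ◁ Ah.quotientMk u K' hcov').left :=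
  haveI : Surjective (Ah.quotientMk u K' hcov').left := ⟨Ah.quotientMk_left_surjective u K' hcov'⟩
  MorphismProperty.of_isPullback
    (ActionOver.IsGeometricQuotient.isPullback_whiskerLeft_left (Ah.quotientMk u K' hcov') B.X) ‹_›

/-- **`1 × ψ̂ : B ×_S Â → B ×_S (Â/K′)` is a geometric quotient for the action `1 × t_•`** (`Y` affine, `K′` acting
without fixed geometric points): `ψ̂` is a FREE affine geometric quotient (★ `isGeometricQuotient_quotientActionOver`,
`quotientActionOver_free`) and free quotients commute with every base change (★
`isGeometricQuotient_baseChange_of_free` on the square ★ `isPullback_whiskerLeft_left`).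
[cite: MumfordAV1970, §7 Thm. 4 (p. 72)] [cite: SGA1, Exp. V Prop. 2.6, Déf. 2.7] -/
theorem isGeometricQuotient_prodTranslationActionOver [IsAffine Y]
    (hfree' : ∀ (Ω : Type u) [Field Ω] [IsAlgClosed Ω] (x : Spec (.of Ω) ⟶ Ah.left) (σ : K'), σ ≠ 1 →
      x ≫ (Ah.translation (σ : Ah.Sections)).left ≠ x) :
    (prodTranslationActionOver B Ah u K' hcov').IsGeometricQuotient (B.X ◁ Ah.quotientMk u K' hcov').left := by
  haveI : Fintype K' := Fintype.ofFinite K'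
  haveI := Ah.isAffineHom_quotientMk_left u K' hcov'
  exact (Ah.isGeometricQuotient_quotientActionOver u K' hcov').isGeometricQuotient_baseChange_of_free
    (Ah.quotientActionOver_free u K' hcov' hfree')
    (ActionOver.IsGeometricQuotient.isPullback_whiskerLeft_left (Ah.quotientMk u K' hcov') B.X)
    (prodTranslationActionOver B Ah u K' hcov') fun k => prodTranslationActionOver_aut_hom_snd B Ah u K' hcov' k

/-- **The action `1 × t_•` on `B ×_S Â` is FREE** (ring form on the affine charts of `B ×_S (Â/K′)`): it covers the
free translation action on `Â` along the equivariant `pr_Â` (★ `IsGeometricQuotient.free_of_equivariant`).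
[cite: SGA1, Exp. V Prop. 2.6 (i), Déf. 2.7] -/
theorem prodTranslationActionOver_free
    (hfree' : ∀ (Ω : Type u) [Field Ω] [IsAlgClosed Ω] (x : Spec (.of Ω) ⟶ Ah.left) (σ : K'), σ ≠ 1 →
      x ≫ (Ah.translation (σ : Ah.Sections)).left ≠ x) :
    ∀ (V : (B.X ⊗ Ah.quotientOver u K').left.Opens), IsAffineOpen V → ∀ k : K', k ≠ 1 →
      Ideal.span (Set.range fun b : Γ((B.X ⊗ Ah.X).left, (B.X ◁ Ah.quotientMk u K' hcov').left ⁻¹ᵁ V) ↦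
        (prodTranslationActionOver B Ah u K' hcov').act k V b - b) = ⊤ := by
  haveI := Ah.isAffineHom_quotientMk_left u K' hcov'
  haveI := isAffineHom_whiskerLeft_quotientMk_left B Ah u K' hcov'
  exact ActionOver.IsGeometricQuotient.free_of_equivariant (Ah.quotientActionOver_free u K' hcov' hfree')
    (prodTranslationActionOver B Ah u K' hcov') (pullback.snd B.X.hom Ah.X.hom) fun k =>
      prodTranslationActionOver_aut_hom_snd B Ah u K' hcov' k

end Literature.AlgebraicGeometry.AbelianSchemes.AbelianSchemeOver

end
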